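import Mathlib
import Summits.HodgeConjecture.FermatCycles.HodgeFermatTheoremLRowsA
import Summits.HodgeConjecture.FermatCycles.HodgeFermatChiThreeB

/-!
# THEOREM L of `tables/DPRIME-THEOREM.md` §3 — the generic rows, part 2: (Z1, Z1) and (U, Z1) (`HodgeFermat/TheoremLRows.lean`; HF-G21d)

Tree copy (part 2 of 2) of the module `HodgeFermat/TheoremLRows.lean` of the sibling cell's standalone package
`run/shared/lean/pub/pub-hodgefermat/lean/HodgeFermat/` (513 lines, sha256 `1379ebcc671acce7…`), source lines 287–513 (§§5–7: the rows (Z1, Z1) `row_Z1Z1` and (U, Z1) `row_UZ1` with their variants, non-vacuity examples).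
Filed by cell `pub-hfermat`, seat prover-1 gen-3, on the COORDINATOR KEEPER RULING of 2026-08-25 (gem sweep H1: take the
off-gate kernel theorem `thmFstar` through the gate) — here THEOREM F* of `tables/DPRIME-THEOREM.md` §9 IN FULL, i.e.
PROPOSITION D′(3N) and the descent (`HodgeFermat/PropDPrimeNFinal.lean`, GATE HF-G34), the last off-gate form of THEOREM F*
(its first two forms, `DecodingFinal.thmFstar` = F* at the prime levels and `ThmFstarNFinal.thmFstar` = F*(3N), landed on
2026-08-25 as `HodgeFermatThmFstar.lean` / `HodgeFermatThmFstarN.lean`, seats prover-1 gen-0 / gen-2); this file is one link of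
the import closure of `PropDPrimeNFinal.propDprime` (the sibling's KR-free chain: THEOREM L, COROLLARY M, THEOREM D6,
THEOREM U⁺, THEOREM KR6, THEOREM Z3U) on top of those landed chains.  The source module is the sibling's hub-checked module of
record (pub-hodgefermat `CERT.md` l.873, GATE HF-G21d; cell record `check/TheoremLRows_standalone.lean` sha256 `afc78fc89e44f5b5…`); its declarations are copied VERBATIM.
Deviations from the source module, exhaustively: the `import` lines (tree modules `Summits.HodgeConjecture.FermatCycles.
HodgeFermat*` instead of `HodgeFermat.*`); this module docstring; the `set_option`/namespace/`open` preamble (source l.41–45) is repeated at the top because the module is split; DEDUP (pre-empting the gate's `dedup.landed`): the source's `lemma inH_mod` (l.473–475) and `lemma sameType_of_fin` (l.477–484) restate the landed `HodgeFermat.KRFree.ChiThree.inH_mod` / `sameType_of_fin` (`HodgeFermatChiThreeB.lean`) VERBATIM and are DELETED, the uses in the non-vacuity examples resolving to the landed lemmas through the added line `export HodgeFermat.KRFree.ChiThree (inH_mod sameType_of_fin)` (extra import; `export` rather than `open` so that the names `TheoremL.inH_mod`/`TheoremL.sameType_of_fin`, used downstream through `open HodgeFermat.KRFree.TheoremL`,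 remain available as aliases of the landed lemmas). The module docstring is quoted in full in part 1.
Every other line — in particular every declaration's statement and proof — is byte-identical to the source.
HONEST FRAMING: explicit algebraic cycles for specific Hodge classes on Fermat/Delsarte varieties; residual open instances
listed; no claim on general Hodge.  (This file is arithmetic of CM types / finite combinatorics / analytic number theory
of the sibling's KR-free programme; it claims nothing about cycles.)
-/

set_option autoImplicit false

namespace HodgeFermat.KRFree.TheoremL

open Finset HodgeFermat.KRFree.LemmaN HodgeFermat.KRFree.LemmaO

export HodgeFermat.KRFree.ChiThree (inH_mod sameType_of_fin)

/-! ## Row (Z1, Z1) -/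

/-- `y + (n−1)y′ ≡ y − y′ (mod n)` is `≢ 0` when `y ≢ y′` -/
lemma diff_repr (n y y' : ℕ) (hn : 0 < n) (hyy' : ¬ y ≡ y' [MOD n]) :
    y + (n - 1) * y' + y' = y + n * y' ∧ ¬ n ∣ y + (n - 1) * y' := by
  have hsum : y + (n - 1) * y' + y' = y + n * y' := by zify [hn]; ring
  refine ⟨hsum, ?_⟩
  rintro ⟨c, hc⟩
  apply hyy'
  show y % n = y' % n
  have e1 : y % n = (y + (n - 1) * y' + y') % n := by rw [hsum, Nat.add_mul_mod_self_left]
  rw [e1, hc, add_comm, Nat.add_mul_mod_self_left]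

/-- **THEOREM L, row (Z1, Z1), quantitative form:** `p(n − g) < 6n` with `g = gcd(y − y′, n)`
(`y − y′` represented by `y + (n−1)y′`). -/
theorem row_Z1Z1 (p n y x₂ x₃ y' x₂' x₃' : ℕ) (hp : p.Prime) (h7 : 7 ≤ p) (hpn : ¬ p ∣ n) (hn : 0 < n)
    (hodd : Odd n) (hs : p * n ∣ p * y + x₂ + x₃) (hx₂ : ¬ p ∣ x₂) (hx₃ : ¬ p ∣ x₃)
    (hs' : p * n ∣ p * y' + x₂' + x₃') (hx₂' : ¬ p ∣ x₂') (hx₃' : ¬ p ∣ x₃')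
    (hyy' : ¬ y ≡ y' [MOD n])
    (hH : SameType (p * n) (p * y, x₂, x₃) (p * y', x₂', x₃')) :
    p * (n - Nat.gcd (y + (n - 1) * y') n) < 6 * n := by
  obtain ⟨hsum, hnz⟩ := diff_repr n y y' hn hyy'
  obtain ⟨u, hu, h2w⟩ := lemmaO_half_sub n (y + (n - 1) * y') hn hodd hnz
  obtain ⟨t₁, ht₁⟩ := exists_t₁ p n u hp hpn hn
  have ht₁u := coprime_t₁ ht₁ hu
  have hE := fibre_identity_Z1Z1 p n y x₂ x₃ y' x₂' x₃' u t₁ hp hpn hn hs hx₂ hx₃ hs' hx₂' hx₃'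
    hu ht₁ hH
  have hd := delta_le n (p * y) x₂ x₃ u t₁ hn (dvd_of_level hs) hu ht₁u
  have hd' := delta_le n (p * y') x₂' x₃' u t₁ hn (dvd_of_level hs') hu ht₁u
  have h3g := three_gcd_le n _ hn hodd hnz
  have hgn : Nat.gcd (y + (n - 1) * y') n ≤ n := Nat.le_of_dvd hn (Nat.gcd_dvd_right _ _)
  have h7n : 7 * n ≤ p * n := Nat.mul_le_mul_right n h7
  -- ⟨uz⟩ + ⟨uy′⟩ ≡ ⟨uy⟩ (mod n)
  have hrel : (u * (y + (n - 1) * y') % n + u * y' % n) % n = u * y % n := by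
    rw [← Nat.add_mod, ← Nat.mul_add, hsum, Nat.mul_add, ← mul_assoc, mul_comm u n, mul_assoc,
      Nat.add_mul_mod_self_left]
  -- opaque names
  obtain ⟨g, hg⟩ : ∃ g, Nat.gcd (y + (n - 1) * y') n = g := ⟨_, rfl⟩
  obtain ⟨w, hwd⟩ : ∃ w, u * (y + (n - 1) * y') % n = w := ⟨_, rfl⟩
  obtain ⟨v, hvd⟩ : ∃ v, u * y % n = v := ⟨_, rfl⟩
  obtain ⟨v', hvd'⟩ : ∃ v', u * y' % n = v' := ⟨_, rfl⟩
  rw [hg] at h2w h3g hgn ⊢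
  rw [hwd] at h2w hrel
  rw [hvd] at hE hrel
  rw [hvd'] at hE hrel
  obtain ⟨k, hk⟩ : ∃ k, p * v / n = k := ⟨_, rfl⟩
  obtain ⟨k', hk'⟩ : ∃ k', p * v' / n = k' := ⟨_, rfl⟩
  rw [hk, hk'] at hE
  obtain ⟨R₀, hR₀⟩ : ∃ R, rsum n (p * y, x₂, x₃) u = R := ⟨_, rfl⟩
  obtain ⟨R₁, hR₁⟩ : ∃ R, rsum n (p * y, x₂, x₃) t₁ = R := ⟨_, rfl⟩
  obtain ⟨R₀', hR₀'⟩ : ∃ R, rsum n (p * y', x₂', x₃') u = R := ⟨_, rfl⟩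
  obtain ⟨R₁', hR₁'⟩ : ∃ R, rsum n (p * y', x₂', x₃') t₁ = R := ⟨_, rfl⟩
  rw [hR₀, hR₁, hR₀', hR₁'] at hE
  rw [hR₀, hR₁] at hd
  rw [hR₀', hR₁'] at hd'
  have hw : w < n := by rw [← hwd]; exact Nat.mod_lt _ hn
  have hv' : v' < n := by rw [← hvd']; exact Nat.mod_lt _ hn
  have hk1 : n * k ≤ p * v := by rw [← hk]; exact Nat.mul_div_le (p * v) n
  have hk2 : p * v < n * k + n := by
    have h1 := Nat.div_add_mod (p * v) n
    have h2 := Nat.mod_lt (p * v) hn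
    rw [hk] at h1
    omega
  have hk1' : n * k' ≤ p * v' := by rw [← hk']; exact Nat.mul_div_le (p * v') n
  have hk2' : p * v' < n * k' + n := by
    have h1 := Nat.div_add_mod (p * v') n
    have h2 := Nat.mod_lt (p * v') hn
    rw [hk'] at h1
    omega
  have hng : n = 2 * w + g := by omega
  have e1 : 2 * (p * w) + p * g = p * n := by rw [hng]; ring
  have e3 : 3 * (p * g) ≤ p * n := by
    calc 3 * (p * g) = p * (3 * g) := by ring
      _ ≤ p * n := Nat.mul_le_mul_left p h3g
  have e4 : p * (n - g) + p * g = p * n := by rw [← Nat.mul_add, Nat.sub_add_cancel hgn]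
  -- w + v′ = v or w + v′ = n + v
  obtain ⟨q, hq, hq2⟩ : ∃ q, w + v' = n * q + v ∧ q < 2 := by
    refine ⟨(w + v') / n, ?_, (Nat.div_lt_iff_lt_mul hn).mpr (by omega)⟩
    have h1 := Nat.div_add_mod (w + v') n
    rw [hrel] at h1
    omega
  interval_cases q
  · have e : p * w + p * v' = p * v := by
      calc p * w + p * v' = p * (w + v') := by ring
        _ = p * (n * 0 + v) := by rw [hq]
        _ = p * v := by ring
    omega
  · have e : p * w + p * v' = p * n + p * v := by
      calc p * w + p * v' = p * (w + v') := by ring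
        _ = p * (n * 1 + v) := by rw [hq]
        _ = p * n + p * v := by ring
    omega

/-- row (Z1, Z1) is impossible for `p ≥ 11` -/
theorem row_Z1Z1_eleven (p n y x₂ x₃ y' x₂' x₃' : ℕ) (hp : p.Prime) (h11 : 11 ≤ p) (hpn : ¬ p ∣ n)
    (hn : 0 < n) (hodd : Odd n) (hs : p * n ∣ p * y + x₂ + x₃) (hx₂ : ¬ p ∣ x₂) (hx₃ : ¬ p ∣ x₃)
    (hs' : p * n ∣ p * y' + x₂' + x₃') (hx₂' : ¬ p ∣ x₂') (hx₃' : ¬ p ∣ x₃')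
    (hyy' : ¬ y ≡ y' [MOD n])
    (hH : SameType (p * n) (p * y, x₂, x₃) (p * y', x₂', x₃')) : False := by
  have h := row_Z1Z1 p n y x₂ x₃ y' x₂' x₃' hp (by omega) hpn hn hodd hs hx₂ hx₃ hs' hx₂' hx₃' hyy' hH
  obtain ⟨_, hnz⟩ := diff_repr n y y' hn hyy'
  have h3g := three_gcd_le n _ hn hodd hnz
  have hgn : Nat.gcd (y + (n - 1) * y') n ≤ n := Nat.le_of_dvd hn (Nat.gcd_dvd_right _ _)
  have h11' : 11 * (n - Nat.gcd (y + (n - 1) * y') n) ≤ p * (n - Nat.gcd (y + (n - 1) * y') n) :=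
    Nat.mul_le_mul_right _ h11
  omega

/-- row (Z1, Z1) at `p = 7`: `n/g < 7` with `g = gcd(y − y′, n)`; as `n/g` is odd and `≥ 3`: `n/g ∈ {3, 5}` -/
theorem row_Z1Z1_seven (n y x₂ x₃ y' x₂' x₃' : ℕ) (h7n : ¬ 7 ∣ n) (hn : 0 < n) (hodd : Odd n)
    (hs : 7 * n ∣ 7 * y + x₂ + x₃) (hx₂ : ¬ 7 ∣ x₂) (hx₃ : ¬ 7 ∣ x₃)
    (hs' : 7 * n ∣ 7 * y' + x₂' + x₃') (hx₂' : ¬ 7 ∣ x₂') (hx₃' : ¬ 7 ∣ x₃')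
    (hyy' : ¬ y ≡ y' [MOD n])
    (hH : SameType (7 * n) (7 * y, x₂, x₃) (7 * y', x₂', x₃')) :
    n / Nat.gcd (y + (n - 1) * y') n = 3 ∨ n / Nat.gcd (y + (n - 1) * y') n = 5 := by
  have h := row_Z1Z1 7 n y x₂ x₃ y' x₂' x₃' (by norm_num) le_rfl h7n hn hodd hs hx₂ hx₃ hs' hx₂' hx₃'
    hyy' hH
  obtain ⟨_, hnz⟩ := diff_repr n y y' hn hyy'
  obtain ⟨n', z', hn'0, hn', _, _, hdn⟩ := decompose n (y + (n - 1) * y') hn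
  have h2 := two_le_quot n _ hn hnz
  have ho := quot_odd n (y + (n - 1) * y') hn hodd
  rw [hdn] at h2 ho ⊢
  have hgn : Nat.gcd (y + (n - 1) * y') n ≤ n := Nat.le_of_dvd hn (Nat.gcd_dvd_right _ _)
  obtain ⟨g, hg⟩ : ∃ g, Nat.gcd (y + (n - 1) * y') n = g := ⟨_, rfl⟩
  rw [hg] at h hgn hn'
  -- 7(n − g) < 6n ⇒ n < 7g ⇒ n′ < 7
  have hlt : g * n' < g * 7 := by rw [← hn']; omega
  have hn'7 : n' < 7 := Nat.lt_of_mul_lt_mul_left hlt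
  rcases ho with ⟨k, hk⟩
  omega

/-! ## Row (U, Z1) -/

/-- **THEOREM L, row (U, Z1), quantitative form:** `(p − 5)·n ≤ 2p·g`, `g = gcd(y, n)`, i.e. `n/g ≤ 2p/(p − 5)`
(stated as `pn ≤ 2pg + 5n`; `n` odd is not needed here). -/
theorem row_UZ1 (p n y x₂ x₃ x' y' z' : ℕ) (hp : p.Prime) (hpn : ¬ p ∣ n) (hn : 0 < n)
    (hs : p * n ∣ p * y + x₂ + x₃) (hx₂ : ¬ p ∣ x₂) (hx₃ : ¬ p ∣ x₃)
    (hs' : p * n ∣ x' + y' + z') (hx' : ¬ p ∣ x') (hy' : ¬ p ∣ y') (hz' : ¬ p ∣ z') (hy : ¬ n ∣ y)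
    (hH : SameType (p * n) (p * y, x₂, x₃) (x', y', z')) :
    p * n ≤ 2 * (p * Nat.gcd y n) + 5 * n := by
  obtain ⟨u, hu, hv⟩ := lemmaO_g n y hn hy
  obtain ⟨t₁, ht₁⟩ := exists_t₁ p n u hp hpn hn
  have ht₁u := coprime_t₁ ht₁ hu
  have hE := fibre_identity_Z1U p n y x₂ x₃ x' y' z' u t₁ hp hpn hn hs hx₂ hx₃ hs' hx' hy' hz' hu ht₁ hH
  have hd := delta_le n (p * y) x₂ x₃ u t₁ hn (dvd_of_level hs) hu ht₁u
  have hd' := delta_le n x' y' z' u t₁ hn (dvd_of_level hs') hu ht₁u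
  rw [hv] at hE
  obtain ⟨g, hg⟩ : ∃ g, Nat.gcd y n = g := ⟨_, rfl⟩
  rw [hg] at hE ⊢
  obtain ⟨k, hk⟩ : ∃ k, p * g / n = k := ⟨_, rfl⟩
  rw [hk] at hE
  obtain ⟨R₀, hR₀⟩ : ∃ R, rsum n (p * y, x₂, x₃) u = R := ⟨_, rfl⟩
  obtain ⟨R₁, hR₁⟩ : ∃ R, rsum n (p * y, x₂, x₃) t₁ = R := ⟨_, rfl⟩
  obtain ⟨R₀', hR₀'⟩ : ∃ R, rsum n (x', y', z') u = R := ⟨_, rfl⟩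
  obtain ⟨R₁', hR₁'⟩ : ∃ R, rsum n (x', y', z') t₁ = R := ⟨_, rfl⟩
  rw [hR₀, hR₁, hR₀', hR₁'] at hE
  rw [hR₀, hR₁] at hd
  rw [hR₀', hR₁'] at hd'
  have hk1 : 2 * n * k ≤ 2 * (p * g) := by
    have h1 : n * k ≤ p * g := by rw [← hk]; exact Nat.mul_div_le (p * g) n
    calc 2 * n * k = 2 * (n * k) := by ring
      _ ≤ 2 * (p * g) := by omega
  omega

/-- row (U, Z1) is impossible for `p ≥ 17` (and `n` odd) -/
theorem row_UZ1_seventeen (p n y x₂ x₃ x' y' z' : ℕ) (hp : p.Prime) (h17 : 17 ≤ p) (hpn : ¬ p ∣ n)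
    (hn : 0 < n) (hodd : Odd n) (hs : p * n ∣ p * y + x₂ + x₃) (hx₂ : ¬ p ∣ x₂) (hx₃ : ¬ p ∣ x₃)
    (hs' : p * n ∣ x' + y' + z') (hx' : ¬ p ∣ x') (hy' : ¬ p ∣ y') (hz' : ¬ p ∣ z') (hy : ¬ n ∣ y)
    (hH : SameType (p * n) (p * y, x₂, x₃) (x', y', z')) : False := by
  have h := row_UZ1 p n y x₂ x₃ x' y' z' hp hpn hn hs hx₂ hx₃ hs' hx' hy' hz' hy hH
  have h3g := three_gcd_le n y hn hodd hy
  have e3 : 3 * (p * Nat.gcd y n) ≤ p * n := by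
    calc 3 * (p * Nat.gcd y n) = p * (3 * Nat.gcd y n) := by ring
      _ ≤ p * n := Nat.mul_le_mul_left p h3g
  have h17n : 17 * n ≤ p * n := Nat.mul_le_mul_right n h17
  omega

/-! ## Consequence: for `p ≥ 17` only (U, U) and (Z3, Z3) remain

(`(Z3, Z3)` is excluded by joint primitivity and is not a statement about one prime.)  The rows above give, for a
prime `p ≥ 17`, `p ∤ n`, `n` odd: no coincidence of level `pn` pairs a Z3-triple with a U- or Z1-triple, no two
Z1-triples with `p`-divisible entries distinct mod `pn`, and no U-triple with a Z1-triple. -/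

/-! ## Non-vacuity: the hypotheses of each row are realised at the excluded small primes

`SameType` quantifies over all `t : ℕ`; it is decided by the residues `t mod N`. -/

/-- (Z3, U) at the excluded prime `p = 3` (`m = 21`): `T = 3·(1, 2, 4)`, `T′ = (1, 4, 16)` — every hypothesis of
`row_Z3U` other than `5 ≤ p` holds -/
example : SameType (3 * 7) (3 * 1, 3 * 2, 3 * 4) (1, 4, 16) := sameType_of_fin (by norm_num) (by decide)

/-- (Z3, Z1) at `p = 3` (`m = 15`, `n = 5`): `T = 3·(1, 1, 3)`, `T′ = (3·1, 1, 11)`, `y = 1 ≢ 0 (mod 5)` — every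
hypothesis of `row_Z3Z1` other than `5 ≤ p` holds -/
example : SameType (3 * 5) (3 * 1, 3 * 1, 3 * 3) (3 * 1, 1, 11) := sameType_of_fin (by norm_num) (by decide)

/-- (Z1, Z1) at `p = 5` (`m = 15`, `n = 3`): `T = (5·2, 1, 4)`, `T′ = (5·1, 2, 8)`, `y = 2 ≢ y′ = 1 (mod 3)` — every
hypothesis of `row_Z1Z1` other than `7 ≤ p` holds -/
example : SameType (5 * 3) (5 * 2, 1, 4) (5 * 1, 2, 8) := sameType_of_fin (by norm_num) (by decide)

/-- (U, Z1) at `p = 5` (`m = 15`, `n = 3`): `T = (5·1, 1, 9)`, `T′ = (1, 1, 13)`: ALL hypotheses of `row_UZ1` hold, and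
the theorem is instantiated (its conclusion reads `15 ≤ 10 + 15`; `row_UZ1_seventeen` needs `17 ≤ p`) -/
example : 5 * 3 ≤ 2 * (5 * Nat.gcd 1 3) + 5 * 3 :=
  row_UZ1 5 3 1 1 9 1 1 13 (by norm_num) (by decide) (by norm_num) (by decide) (by decide) (by decide)
    (by decide) (by decide) (by decide) (by decide) (by decide) (sameType_of_fin (by norm_num) (by decide))

/-! ## Kernel instances (`decide`) at `p = 7`, `n = 11` -/

/-- Z3-triple `(7, 14, 56)` of level 77: `N_T(3̄) = 6 = p − 1` and `N_T(4̄) = 0` -/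
example : fibreCount 7 11 (7 * 1, 7 * 2, 7 * 8) 3 = 6 ∧ fibreCount 7 11 (7 * 1, 7 * 2, 7 * 8) 4 = 0 := by
  decide

/-- carries at two units differ by at most one (and do differ): `T̄ = (1, 2, 8)` mod 11 (from the U-triple
`(1, 2, 74)` of level 77), units 1 and 4: residue sums 11 and 22 -/
example : rsum 11 (1, 2, 74) 1 = 11 ∧ rsum 11 (1, 2, 74) 4 = 22 := by decide

end HodgeFermat.KRFree.TheoremL
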